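import Mathlib
import Literature.Probability.LatticeModels.LatticeGraph
import HarnessLib

/-!
# Complex spin systems of strongly coupled lattice gauge theory and the Salmhofer–Seiler
# infrared bound (Salmhofer–Seiler, CMP 139 (1991), Def. 3.1 / Remark 3.2 / Thm. 3.21)

At infinite bare gauge coupling `β = 0`, `U(N)` lattice gauge theory with staggered fermions (and
the gauged Nambu–Jona-Lasinio models obtained by adding a four-fermion term) becomes, after the
one-link Haar integrals and a site-wise bosonisation, a **complex spin system**: spins
`σ_x ∈ ℂ` on the unit circle, site weights `F_x(σ_x)`, bond weights `B(σ_x σ_y)`, integrated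
against `∏_x dσ_x /(2πi σ_x) σ_x^{-N}` (Salmhofer–Seiler 1991, (2.21) and Definition 3.1).  By
their Remark 3.2 only the Taylor truncations to degree `≤ N` matter and the contour integral is the
extraction of the coefficient of `∏_x σ_x^N`; this file therefore renders the system as honest
coefficient extraction in `MvPolynomial (TorusSite ν L) ℝ` — no contour integrals, no measure
theory.  The paper's normalisations are kept: `F_x(z) = e^{2Nmz}` (site weight of Thms. 3.18,
3.23, 4.3, 4.8), `B_xy(t) = exp(N W(t))`, `W(t) = ∑_{k=1}^{N} w_k t^k` ((3.58), (3.71)–(3.72)),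
`V(t) = W(t) - t`, `e^{N V(t)} = ∑_k b_k t^k` (3.73).

Vendored: ONE named fact, `SalmhoferSeiler1991_infraredBound` = Theorem 3.21 (Infrared Bound) of
the paper, in the special case `F_x(z) = e^{2Nmz}` in which it is applied there (Thm. 3.23,
Remark 4.5, Thm. 4.8), on tori `(ℤ/Lℤ)^ν` with one common EVEN side `L ≥ 4` (the paper allows
unequal even sides `L_μ ∈ 2ℕ`; `L ≥ 4` avoids the double bonds of the side-2 torus — a special
case, never stronger than print):
if `b_k ≥ 0` for `k ∈ {0,…,N}` then for every `h : Λ → ℝ`,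
`⟨σ(h) σ(-Δh)⟩_Λ ≤ (1/N) ‖h‖²` (3.74) and `⟨σ(h) σ(Δ̄h)⟩_Λ ≥ -(1/N) ‖h‖²` (3.75), with `Δ` the
lattice Laplacean, `(Δ̄f)(x) = ∑_μ (f(x+e_μ) + f(x-e_μ) + 2 f(x))` its antiferromagnetic
counterpart (3.76), `σ(h) = ∑_x σ_x h_x`, `‖h‖² = ∑_x h_x²` (3.77).

This is the engine of the paper's chiral-symmetry-breaking results (Thm. 4.3/Cor. 4.4: QED and NJL;
Thm. 4.8/Cor. 4.9: chiral long-range order for `U(N)`, `N ≤ 4`, `ν ≥ 4`), which are NOT vendored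
here (they are infinite-volume statements; see the cell memo
`run/shared/lean/pub/pub-ymgap/qcd-lit/SALMHOFER-SEILER-LOCI.md`).  Honest framing: a
finite-volume inequality for a polynomial "spin system" at `β = 0`; nothing about `β > 0`, the
continuum, or the summit's `QCD` conjunct.

## Contents

* `ComplexSpin.siteWeight`, `fluctCoeff` (`b_k`), `uNBondCoeff` ((2.23), the `U(N)` model),
  `njlBondCoeff` (Def. 3.3(1)), `bondWeight`, `boltzmann`, `topExponent`, `bracket` (`[Φ]_Λ`),
  `partitionFunction` (`Z_Λ`), `expect` (`⟨Φ⟩_Λ`), `field` (`σ(h)`), `laplacian` (`Δ`),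
  `afLaplacian` (`Δ̄`), `normSq` — real definitions;
* API: `expect_eq_div`, `expect_one`, `laplacian_const`, `normSq_nonneg`; the hypotheses of the
  infrared bound for the two printed models — `uNBondCoeff_zero/one`, `njlBondCoeff_zero/one`
  (`a_0 = 1`, `a_1 = N`), **Remark 4.5 proved for every `N`** (`uN_fluctCoeff_nonneg`, through
  the finite-sum version `fluctAux`/`fluctC` of (4.22) and the recursion (4.26), `fluctC_rec`,
  `fluctC_nonneg`), `fluctCoeff_njl` (`b_k = δ_{k0}`, Remark 3.22) — all proved;
* the named fact `SalmhoferSeiler1991_infraredBound` (cited, not proved here) and its proved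
  specialisations `SalmhoferSeiler1991_infraredBound.uN` (`U(N)`, every `N ≥ 1`) and `.njl`.

## Design / faithfulness notes

* The bond weight is parametrised by its Taylor coefficients `a_0 = 1, a_1, …, a_N`
  (`B(t) = ∑_k a_k t^k`, Def. 3.1: "`B_i` analytic at zero with `B_i(0) = 1`") rather than by
  `W = N⁻¹ log B`; the two parametrisations determine each other degree by degree, the paper's
  normalisation `w₁ = 1` reads `a_1 = N`, and `b_k` (3.73) is the `t^k`-coefficient of
  `B(t) e^{-Nt} = e^{N V(t)}` (`fluctCoeff`).  The `U(N)` model is `a` = `uNBondCoeff N` ((2.23)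
  with `g₄ = 0`), the NJL system / strongly coupled QED is `a` = `njlBondCoeff N`.
* Real coefficients throughout (`m, a_k ∈ ℝ`), so `[Φ]_Λ ∈ ℝ` and (3.74)–(3.75) are inequalities
  of real numbers, as in print (`F(z) = conj F(z̄)`, (3.52)/(3.71)).
* `⟨Φ⟩_Λ := [Φ]_Λ / Z_Λ` with Lean's `x / 0 = 0`: Definition 3.1 defines expectations only for
  `Z_G ≠ 0`; when `Z_Λ = 0` both printed inequalities hold trivially for the junk value, so no
  hypothesis is added and nothing is strengthened.
* Bonds are enumerated as links `(x, μ) ↦ (x, x + e_μ)`, exactly the sum `∑_{x,μ}` of (2.21); for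
  `L ≥ 3` this lists each nearest-neighbour bond of the torus once.
* `B` and `e^{N V}` are power series; only their coefficients of `t^k`, `k ≤ N`, can contribute
  under `[∏ σ_x^N]` (Remark 3.2), so `bondWeight` truncates at degree `N` and the hypothesis
  `b_k ≥ 0` is asked for `k ≤ N` exactly as printed.  Likewise `F(z) = e^{2Nmz}` enters through
  its Taylor coefficients `(2Nm)^j/j!`, `j ≤ N` (`siteWeight`).
* Not transcribed: Def. 3.1 on general graphs with site-dependent `F_x`, `B_i`; the `g₄ > 0`
  four-fermion coupling (it multiplies `B` by `e^{4Ng₄t}` and is absorbed into `w₁ = 1` by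
  rescaling, Remark 3.4(4)); reflection positivity (Prop. 3.15), chessboard bounds (Thm. 3.17),
  Gaussian domination (3.98)–(3.99).  Remark 4.5 (`b_k ≥ 0` for the `U(N)` model, all `N`) IS
  proved here, along the printed route (4.20)–(4.26) with the integral
  `∫_0^∞ e^{-t}(1 - t/N)^m t^n dt` replaced by its value `∑_j C(m,j)(-1/N)^j (n+j)!`.

## References

* M. Salmhofer, E. Seiler, *Proof of chiral symmetry breaking in strongly coupled lattice gauge
  theory*, Commun. Math. Phys. 139 (1991) 395–432, Def. 3.1, Remark 3.2, Def. 3.3, Thm. 3.21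
  (pp. 402–403, 412–413). [SalmhoferSeiler1991]
* M. Salmhofer, E. Seiler, Erratum, Commun. Math. Phys. 146 (1992) 637–638 (concerns Thm. 3.11
  only). [SalmhoferSeiler1992Erratum]
* J. Fröhlich, B. Simon, T. Spencer, Commun. Math. Phys. 50 (1976) 79 (the method).
  [FrohlichSimonSpencer1976]
-/

noncomputable section

open MvPolynomial Finset

namespace Literature.MathematicalPhysics.StatisticalMechanics

open Literature.Probability.LatticeModels (TorusSite)

namespace ComplexSpin

variable {ν L : ℕ}

/-! ### The complex spin system as coefficient extraction -/

/-- The truncated site weight `F^{≤N}(σ_x) = ∑_{j=0}^{N} (2Nm)^j/j! · σ_x^j`, the Taylor polynomial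
of the site weight `F_x(z) = e^{2Nmz}` of Salmhofer–Seiler (2.21)/(3.58) (only degrees `≤ N`
matter, Remark 3.2). [cite: SalmhoferSeiler1991, (2.21) and Remark 3.2] -/
def siteWeight (N : ℕ) (m : ℝ) (x : TorusSite ν L) : MvPolynomial (TorusSite ν L) ℝ :=
  ∑ j ∈ range (N + 1), C ((2 * N * m) ^ j / (Nat.factorial j : ℝ)) * X x ^ j

/-- The Taylor coefficients `b_k` of `e^{N V(t)}`, `V(t) = W(t) - t` (3.73), expressed through the
Taylor coefficients `a_k` of the bond Boltzmann factor `B(t) = exp(N W(t)) = ∑_k a_k t^k` ((3.53),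
(3.71)): since `e^{NV(t)} = B(t) e^{-Nt}`, `b_k = ∑_{j=0}^{k} a_j (-N)^{k-j} / (k-j)!`.  Their
nonnegativity for `k ≤ N` is the hypothesis of the infrared bound. [cite: SalmhoferSeiler1991, (3.73)] -/
def fluctCoeff (N : ℕ) (a : ℕ → ℝ) (k : ℕ) : ℝ :=
  ∑ j ∈ range (k + 1), a j * (-(N : ℝ)) ^ (k - j) / (Nat.factorial (k - j) : ℝ)

/-- The bond data of the `U(N)` model at four-fermion coupling `g₄ = 0`:
`a_k = (N-k)!/(N! k!) · N^{2k}` for `k ≤ N`, `0` beyond ((2.23), (3.8); from the one-link `U(N)`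
integral of Rossi–Wolff, (2.16)–(2.17)).  Note `a_0 = 1` and `a_1 = N`, i.e. `w₁ = 1`. [cite: SalmhoferSeiler1991, (2.23) and Def. 3.3(2)] -/
def uNBondCoeff (N : ℕ) (k : ℕ) : ℝ :=
  if k ≤ N then (Nat.factorial (N - k) : ℝ) / ((Nat.factorial N : ℝ) * (Nat.factorial k : ℝ)) *
    (N : ℝ) ^ (2 * k) else 0

/-- The bond data of the NJL system (`W(t) = w₁ t`, `w₁ = 1`; strongly coupled QED is `N = 1`):
`B(t) = e^{Nt}`, `a_k = N^k / k!` (Def. 3.3(1), Remark 3.4(1),(4)). [cite: SalmhoferSeiler1991, Def. 3.3(1)] -/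
def njlBondCoeff (N : ℕ) (k : ℕ) : ℝ :=
  (N : ℝ) ^ k / (Nat.factorial k : ℝ)

/-- The truncated bond weight `B^{≤N}(σ_x σ_y) = ∑_{k=0}^{N} a_k (σ_x σ_y)^k` on the bond `(x, y)`
(only degrees `≤ N` matter, Remark 3.2). [cite: SalmhoferSeiler1991, Def. 3.1 and Remark 3.2] -/
def bondWeight (N : ℕ) (a : ℕ → ℝ) (x y : TorusSite ν L) : MvPolynomial (TorusSite ν L) ℝ :=
  ∑ k ∈ range (N + 1), C (a k) * (X x * X y) ^ k

/-- The Boltzmann polynomial `∏_x F(σ_x) · ∏_{x,μ} B(σ_x σ_{x+e_μ})` of the complex spin system on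
the torus `(ℤ/Lℤ)^ν` (the integrand of (2.21) / (3.1), bonds listed as links `(x, μ)`).
[cite: SalmhoferSeiler1991, (2.21) and Def. 3.3(3)] -/
def boltzmann [NeZero L] (N : ℕ) (m : ℝ) (a : ℕ → ℝ) : MvPolynomial (TorusSite ν L) ℝ :=
  (∏ x : TorusSite ν L, siteWeight N m x) *
    ∏ x : TorusSite ν L, ∏ μ : Fin ν, bondWeight N a x (x + Pi.single μ 1)

/-- The exponent vector of the top monomial `∏_x σ_x^N`. [cite: SalmhoferSeiler1991, Remark 3.2] -/
def topExponent [NeZero L] (N : ℕ) : TorusSite ν L →₀ ℕ :=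
  Finsupp.equivFunOnFinite.symm fun _ => N

/-- The unnormalised expectation `[Φ]_Λ`: the contour integral
`∮ ∏_x dσ_x/(2πiσ_x) σ_x^{-N} F(σ_x) ∏ B(σ_xσ_y) Φ(σ)` over unit circles equals the coefficient
of `∏_x σ_x^N` in `Φ · (Boltzmann polynomial)` (Remark 3.2). [cite: SalmhoferSeiler1991, (3.1)–(3.2) and Remark 3.2] -/
def bracket [NeZero L] (N : ℕ) (m : ℝ) (a : ℕ → ℝ) (Φ : MvPolynomial (TorusSite ν L) ℝ) : ℝ :=
  coeff (topExponent N) (Φ * boltzmann N m a)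

/-- The partition function `Z_Λ = [1]_Λ` (3.1). [cite: SalmhoferSeiler1991, (3.1)] -/
def partitionFunction [NeZero L] (N : ℕ) (m : ℝ) (a : ℕ → ℝ) : ℝ :=
  bracket (ν := ν) (L := L) N m a 1

/-- The expectation `⟨Φ⟩_Λ = [Φ]_Λ / Z_Λ` (3.2) (junk `0` if `Z_Λ = 0`, where the paper leaves it
undefined). [cite: SalmhoferSeiler1991, (3.2)] -/
def expect [NeZero L] (N : ℕ) (m : ℝ) (a : ℕ → ℝ) (Φ : MvPolynomial (TorusSite ν L) ℝ) : ℝ :=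
  bracket N m a Φ / partitionFunction (ν := ν) (L := L) N m a

/-- The smeared spin `σ(h) = (σ, h) = ∑_x σ_x h_x` (3.77). [cite: SalmhoferSeiler1991, (3.77)] -/
def field [NeZero L] (h : TorusSite ν L → ℝ) : MvPolynomial (TorusSite ν L) ℝ :=
  ∑ x : TorusSite ν L, C (h x) * X x

/-- The lattice Laplacean on the torus, `(Δf)(x) = ∑_μ (f(x+e_μ) + f(x-e_μ) - 2 f(x))` (3.76).
[cite: SalmhoferSeiler1991, (3.76)] -/
def laplacian (f : TorusSite ν L → ℝ) (x : TorusSite ν L) : ℝ :=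
  ∑ μ : Fin ν, (f (x + Pi.single μ 1) + f (x - Pi.single μ 1) - 2 * f x)

/-- The antiferromagnetic Laplacean `(Δ̄f)(x) = ∑_μ (f(x+e_μ) + f(x-e_μ) + 2 f(x))` (3.76).
[cite: SalmhoferSeiler1991, (3.76)] -/
def afLaplacian (f : TorusSite ν L → ℝ) (x : TorusSite ν L) : ℝ :=
  ∑ μ : Fin ν, (f (x + Pi.single μ 1) + f (x - Pi.single μ 1) + 2 * f x)

/-- `‖h‖² = (h, h) = ∑_x h_x²` (3.77). [cite: SalmhoferSeiler1991, (3.77)] -/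
def normSq [NeZero L] (h : TorusSite ν L → ℝ) : ℝ :=
  ∑ x : TorusSite ν L, h x ^ 2

/-! ### API -/

/-- Unfolding `⟨Φ⟩_Λ = [Φ]_Λ / Z_Λ`. [cite: SalmhoferSeiler1991, (3.2)] -/
theorem expect_eq_div [NeZero L] (N : ℕ) (m : ℝ) (a : ℕ → ℝ)
    (Φ : MvPolynomial (TorusSite ν L) ℝ) :
    expect N m a Φ = bracket N m a Φ / partitionFunction (ν := ν) (L := L) N m a := rfl

/-- `⟨1⟩_Λ = 1` whenever `Z_Λ ≠ 0` (Def. 3.1). [cite: SalmhoferSeiler1991, (3.2)] -/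
theorem expect_one [NeZero L] (N : ℕ) (m : ℝ) (a : ℕ → ℝ)
    (hZ : partitionFunction (ν := ν) (L := L) N m a ≠ 0) :
    expect (ν := ν) (L := L) N m a 1 = 1 := by
  unfold expect
  exact div_self hZ

/-- The Laplacean (3.76) kills constants (used in the paper as `H_Λ(Φ) = H_Λ(0)` for constant
shifts, (3.94)). [cite: SalmhoferSeiler1991, (3.76) and (3.94)] -/
theorem laplacian_const (c : ℝ) (x : TorusSite ν L) : laplacian (fun _ => c) x = 0 := by
  simp only [laplacian]
  exact Finset.sum_eq_zero fun _ _ => by ring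

/-- `‖h‖² = (h,h) ≥ 0` for the norm of (3.77). [cite: SalmhoferSeiler1991, (3.77)] -/
theorem normSq_nonneg [NeZero L] (h : TorusSite ν L → ℝ) : 0 ≤ normSq h :=
  Finset.sum_nonneg fun _ _ => sq_nonneg _

/-- `B(0) = 1` for the `U(N)` bond data: `a_0 = 1`. [cite: SalmhoferSeiler1991, (2.23)] -/
theorem uNBondCoeff_zero (N : ℕ) : uNBondCoeff N 0 = 1 := by
  have h : (Nat.factorial N : ℝ) ≠ 0 := by positivity
  simp [uNBondCoeff, h]

/-- The `U(N)` bond data have `a_1 = N`, i.e. the paper's normalisation `w₁ = 1` holds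
((2.23): "In particular, `w₁ = 1 + 4Ng₄`", here `g₄ = 0`). [cite: SalmhoferSeiler1991, (2.23)] -/
theorem uNBondCoeff_one {N : ℕ} (hN : 1 ≤ N) : uNBondCoeff N 1 = N := by
  obtain ⟨n, rfl⟩ := Nat.exists_eq_add_of_le hN
  have h1 : (Nat.factorial n : ℝ) ≠ 0 := by positivity
  simp only [uNBondCoeff, hN, if_true, Nat.factorial_one, Nat.cast_one, mul_one]
  rw [show 1 + n - 1 = n from by omega, show (1 + n).factorial = (n + 1).factorial from by ring_nf,
    Nat.factorial_succ]
  push_cast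
  field_simp
  ring

/-- `B(0) = 1` for the NJL bond data: `a_0 = 1`. [cite: SalmhoferSeiler1991, Def. 3.3(1)] -/
theorem njlBondCoeff_zero (N : ℕ) : njlBondCoeff N 0 = 1 := by
  simp [njlBondCoeff]

/-- The NJL bond data have `a_1 = N` (`w₁ = 1`). [cite: SalmhoferSeiler1991, Def. 3.3(1) and Remark 3.4(4)] -/
theorem njlBondCoeff_one (N : ℕ) : njlBondCoeff N 1 = N := by
  simp [njlBondCoeff]

/-! ### Remark 4.5: the `U(N)` model satisfies `b_k ≥ 0` (all `N`)

Salmhofer–Seiler prove `b_m ≥ 0` through `c_m := m! N! b_m = ∫_0^∞ e^{-t} (1 - t/N)^m t^{N-m} dt`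
(4.22) and the recursion `(N-m+1) c_m = (2/N)(m-1) c_{m-1} + ((m-1)/N²) c_{m-2}` (4.26) obtained by
two integrations by parts.  We run the same argument on the finite sums
`J_y(m, n) := ∑_{j=0}^{m} C(m,j) y^j (n+j)!` (`= ∫_0^∞ e^{-t}(1 + y t)^m t^n dt`), `y = -1/N`, for
which "integration by parts" and "`t = N(1 - (1 - t/N))`" are the binomial identities
`fluctAux_succ_succ` and `fluctAux_succ_left`. -/

/-- `J_y(m, n) = ∑_{j=0}^{m} C(m,j) y^j (n+j)!`, the finite-sum form of
`∫_0^∞ e^{-t} (1 + yt)^m t^n dt`; at `y = -1/N`, `n = N - m` this is Salmhofer–Seiler's `c_m`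
(4.22). [cite: SalmhoferSeiler1991, (4.22)] -/
def fluctAux (y : ℝ) (m n : ℕ) : ℝ :=
  ∑ j ∈ range (m + 1), (Nat.choose m j : ℝ) * y ^ j * (Nat.factorial (n + j) : ℝ)

/-- Integration by parts in finite-sum form: `J(m+1, n+1) = (n+1) J(m+1, n) + (m+1) y J(m, n+1)`
(the first of the two partial integrations behind (4.23)–(4.25)). [cite: SalmhoferSeiler1991, (4.23)–(4.25)] -/
theorem fluctAux_succ_succ (y : ℝ) (m n : ℕ) :
    fluctAux y (m + 1) (n + 1) =
      (n + 1) * fluctAux y (m + 1) n + (m + 1) * y * fluctAux y m (n + 1) := by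
  have A : ∑ j ∈ range (m + 1 + 1), (Nat.choose (m + 1) j : ℝ) * y ^ j *
        (Nat.factorial (n + 1 + j) : ℝ)
      = (n + 1) * ∑ j ∈ range (m + 1 + 1), (Nat.choose (m + 1) j : ℝ) * y ^ j *
          (Nat.factorial (n + j) : ℝ)
        + ∑ j ∈ range (m + 1 + 1), (Nat.choose (m + 1) j : ℝ) * y ^ j *
          ((j : ℝ) * (Nat.factorial (n + j) : ℝ)) := by
    rw [mul_sum, ← sum_add_distrib]
    refine sum_congr rfl fun j _ => ?_
    rw [show n + 1 + j = (n + j) + 1 from by ring, Nat.factorial_succ]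
    push_cast
    ring
  have B : ∑ j ∈ range (m + 1 + 1), (Nat.choose (m + 1) j : ℝ) * y ^ j *
        ((j : ℝ) * (Nat.factorial (n + j) : ℝ))
      = (m + 1) * y * ∑ j ∈ range (m + 1), (Nat.choose m j : ℝ) * y ^ j *
          (Nat.factorial (n + 1 + j) : ℝ) := by
    rw [sum_range_succ' _ (m + 1)]
    simp only [Nat.cast_zero, zero_mul, mul_zero, add_zero]
    rw [mul_sum]
    refine sum_congr rfl fun k _ => ?_
    have hc : ((m + 1 : ℕ) : ℝ) * (Nat.choose m k : ℝ) =
        (Nat.choose (m + 1) (k + 1) : ℝ) * ((k + 1 : ℕ) : ℝ) := by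
      exact_mod_cast Nat.add_one_mul_choose_eq m k
    push_cast at hc ⊢
    rw [show n + (k + 1) = n + 1 + k from by ring, pow_succ]
    linear_combination (-(y ^ k * y * (Nat.factorial (n + 1 + k) : ℝ))) * hc
  unfold fluctAux
  rw [A, B]

/-- Pascal's rule in finite-sum form: `J(m+1, n) = J(m, n) + y J(m, n+1)` (the substitution
`t = N(1 - (1 - t/N))` of the printed argument). [cite: SalmhoferSeiler1991, (4.22)–(4.26)] -/
theorem fluctAux_succ_left (y : ℝ) (m n : ℕ) :
    fluctAux y (m + 1) n = fluctAux y m n + y * fluctAux y m (n + 1) := by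
  unfold fluctAux
  rw [sum_range_succ' _ (m + 1)]
  simp only [Nat.choose_zero_right, Nat.cast_one, pow_zero, one_mul, add_zero, mul_one]
  have hP : ∀ k : ℕ, (Nat.choose (m + 1) (k + 1) : ℝ) =
      (Nat.choose m k : ℝ) + (Nat.choose m (k + 1) : ℝ) := by
    intro k; exact_mod_cast Nat.choose_succ_succ' m k
  simp_rw [hP, add_mul, sum_add_distrib]
  have h1 : ∑ k ∈ range (m + 1), (Nat.choose m k : ℝ) * y ^ (k + 1) *
        (Nat.factorial (n + (k + 1)) : ℝ)
      = y * ∑ j ∈ range (m + 1), (Nat.choose m j : ℝ) * y ^ j *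
          (Nat.factorial (n + 1 + j) : ℝ) := by
    rw [mul_sum]; refine sum_congr rfl fun k _ => ?_
    rw [show n + (k + 1) = n + 1 + k from by ring, pow_succ]; ring
  have h2 : ∑ k ∈ range (m + 1), (Nat.choose m (k + 1) : ℝ) * y ^ (k + 1) *
        (Nat.factorial (n + (k + 1)) : ℝ) + (Nat.factorial (n + 0) : ℝ)
      = ∑ j ∈ range (m + 1), (Nat.choose m j : ℝ) * y ^ j * (Nat.factorial (n + j) : ℝ) := by
    rw [sum_range_succ' (fun j => (Nat.choose m j : ℝ) * y ^ j * (Nat.factorial (n + j) : ℝ)) m]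
    simp only [Nat.choose_zero_right, Nat.cast_one, pow_zero, one_mul, mul_one]
    congr 1
    rw [sum_range_succ]
    simp [Nat.choose_succ_self]
  simp only [Nat.add_zero] at h2
  linarith [h1, h2]

/-- The three-term recursion behind (4.26), for general `y`:
`(n+1) J(k+2, n) = (1 + (n+1)y - (k+1)y) J(k+1, n+1) + (k+1) y² J(k, n+2)`.
[cite: SalmhoferSeiler1991, (4.26)] -/
theorem fluctAux_rec (y : ℝ) (k n : ℕ) :
    (n + 1) * fluctAux y (k + 2) n =
      (1 + (n + 1) * y - (k + 1) * y) * fluctAux y (k + 1) (n + 1) +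
        (k + 1) * y ^ 2 * fluctAux y k (n + 2) := by
  have E1 := fluctAux_succ_left y (k + 1) n
  have E2 := fluctAux_succ_succ y k n
  have E3 := fluctAux_succ_left y k (n + 1)
  linear_combination (n + 1) * E1 - E2 + (k + 1) * y * E3

/-- Salmhofer–Seiler's `c_m = m! N! b_m = ∫_0^∞ e^{-t}(1 - t/N)^m t^{N-m} dt` (4.22), as the finite
sum `J_{-1/N}(m, N - m)`. [cite: SalmhoferSeiler1991, (4.22)] -/
def fluctC (N m : ℕ) : ℝ := fluctAux (-1 / (N : ℝ)) m (N - m)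

/-- `c_0 = N!` (4.26). [cite: SalmhoferSeiler1991, (4.26)] -/
theorem fluctC_zero (N : ℕ) : fluctC N 0 = Nat.factorial N := by
  simp [fluctC, fluctAux]

/-- `c_1 = 0` ("By construction, `b_1 = 0`", (4.20)–(4.21)). [cite: SalmhoferSeiler1991, (4.21)] -/
theorem fluctC_one {N : ℕ} (hN : 1 ≤ N) : fluctC N 1 = 0 := by
  obtain ⟨n, rfl⟩ := Nat.exists_eq_add_of_le hN
  simp only [fluctC, fluctAux]
  rw [show 1 + n - 1 = n from by omega]
  simp [Finset.sum_range_succ, Nat.factorial_succ]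
  have h : ((1 + n : ℕ) : ℝ) ≠ 0 := by positivity
  field_simp
  ring

/-- **The recursion (4.26)**: `(N-m+1) c_m = (2/N)(m-1) c_{m-1} + ((m-1)/N²) c_{m-2}`, written with
`m = k + 2 ≤ N`. [cite: SalmhoferSeiler1991, (4.26)] -/
theorem fluctC_rec {N k : ℕ} (hk : k + 2 ≤ N) :
    ((N - (k + 2) : ℕ) + 1 : ℝ) * fluctC N (k + 2) =
      (2 * (k + 1) / (N : ℝ)) * fluctC N (k + 1) + ((k + 1) / (N : ℝ) ^ 2) * fluctC N k := by
  have hN : (N : ℝ) ≠ 0 := by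
    have : 0 < N := by omega
    positivity
  have h1 : N - (k + 1) = (N - (k + 2)) + 1 := by omega
  have h2 : N - k = (N - (k + 2)) + 2 := by omega
  have R := fluctAux_rec (-1 / (N : ℝ)) k (N - (k + 2))
  simp only [fluctC]
  rw [h1, h2]
  have hcoef : (1 + (((N - (k + 2) : ℕ) : ℝ) + 1) * (-1 / (N : ℝ)) - (k + 1) * (-1 / (N : ℝ)))
      = 2 * (k + 1) / (N : ℝ) := by
    have : (((N - (k + 2) : ℕ) : ℝ) + 1) = (N : ℝ) - (k + 1) := by
      have : ((N - (k + 2) : ℕ) : ℝ) = (N : ℝ) - (k + 2) := by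
        rw [Nat.cast_sub hk]; push_cast; ring
      rw [this]; ring
    rw [this]; field_simp; ring
  rw [hcoef] at R
  rw [R]
  congr 1
  field_simp

/-- `c_m ≥ 0` for all `m ≤ N` ("Since `c_0 = N!` and `c_1 = 0`, this implies `c_m ≥ 0` for all
`m ∈ {0,…,N}`", p. 421). [cite: SalmhoferSeiler1991, Remark 4.5] -/
theorem fluctC_nonneg {N : ℕ} (hN : 1 ≤ N) : ∀ m, m ≤ N → 0 ≤ fluctC N m := by
  intro m
  induction m using Nat.strong_induction_on with
  | _ m ih =>
    intro hm
    match m, ih, hm with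
    | 0, _, _ => rw [fluctC_zero]; positivity
    | 1, _, _ => rw [fluctC_one hN]
    | k + 2, ih, hm =>
      have hk1 : 0 ≤ fluctC N (k + 1) := ih (k + 1) (by omega) (by omega)
      have hk0 : 0 ≤ fluctC N k := ih k (by omega) (by omega)
      have R := fluctC_rec hm
      have hpos : (0 : ℝ) < ((N - (k + 2) : ℕ) : ℝ) + 1 := by positivity
      have hNpos : (0 : ℝ) < (N : ℝ) := by exact_mod_cast (show 0 < N by omega)
      have hrhs : 0 ≤ (2 * (k + 1) / (N : ℝ)) * fluctC N (k + 1) +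
          ((k + 1) / (N : ℝ) ^ 2) * fluctC N k := by
        positivity
      nlinarith [R, hrhs, hpos]

/-- `b_m = N^{2m} c_m / (N! m!)` for the `U(N)` bond data and `m ≤ N` ((4.21)–(4.22) in the
`t = N^{-2} u` normalisation of (2.23)). [cite: SalmhoferSeiler1991, (4.21)–(4.22)] -/
theorem fluctCoeff_uN_eq {N m : ℕ} (hN : 1 ≤ N) (hm : m ≤ N) :
    fluctCoeff N (uNBondCoeff N) m =
      (N : ℝ) ^ (2 * m) / ((Nat.factorial N : ℝ) * (Nat.factorial m : ℝ)) * fluctC N m := by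
  have hN0 : (N : ℝ) ≠ 0 := by exact_mod_cast (show N ≠ 0 by omega)
  unfold fluctCoeff fluctC fluctAux
  rw [mul_sum, ← sum_range_reflect _ (m + 1)]
  refine sum_congr rfl fun j hj => ?_
  have hjm : j ≤ m := Nat.lt_succ_iff.mp (mem_range.mp hj)
  obtain ⟨e, rfl⟩ := Nat.exists_eq_add_of_le hjm
  have heN : e ≤ N := by omega
  rw [show j + e + 1 - 1 - j = e from by omega, show j + e - e = j from by omega,
    show N - (j + e) + j = N - e from by omega]
  simp only [uNBondCoeff, heN, if_true]
  have hC : (Nat.choose (j + e) j : ℝ) * (Nat.factorial j : ℝ) * (Nat.factorial e : ℝ)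
      = (Nat.factorial (j + e) : ℝ) := by
    have := Nat.choose_mul_factorial_mul_factorial (Nat.le_add_right j e)
    rw [show j + e - j = e from by omega] at this
    exact_mod_cast this
  have hj0 : (Nat.factorial j : ℝ) ≠ 0 := by positivity
  have he0 : (Nat.factorial e : ℝ) ≠ 0 := by positivity
  have hC' : (Nat.choose (j + e) j : ℝ) =
      (Nat.factorial (j + e) : ℝ) / ((Nat.factorial j : ℝ) * (Nat.factorial e : ℝ)) := by
    rw [eq_div_iff (mul_ne_zero hj0 he0), ← hC]; ring
  rw [hC', neg_pow, show (-1 / (N : ℝ)) = (-1) * (N : ℝ)⁻¹ from by ring, mul_pow, inv_pow]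
  have hNf : (Nat.factorial N : ℝ) ≠ 0 := by positivity
  have hje : (Nat.factorial (j + e) : ℝ) ≠ 0 := by positivity
  field_simp
  ring

/-- **Remark 4.5** ("The `U(N)`-model fulfills the requirements of Theorem 3.21"): the `U(N)` bond
data satisfy `b_k ≥ 0` for all `k ≤ N`, every `N ≥ 1`. [cite: SalmhoferSeiler1991, Remark 4.5] -/
theorem uN_fluctCoeff_nonneg {N : ℕ} (hN : 1 ≤ N) (k : ℕ) (hk : k ≤ N) :
    0 ≤ fluctCoeff N (uNBondCoeff N) k := by
  rw [fluctCoeff_uN_eq hN hk]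
  have := fluctC_nonneg hN k hk
  positivity

/-- In the NJL system `V = W - t = 0`, so `e^{NV} = 1`: `b_k = δ_{k0}`; in particular the hypothesis
`b_k ≥ 0` of the infrared bound holds (Remark 3.22: "For the NJL model `V(t) = 0`").
[cite: SalmhoferSeiler1991, Remark 3.22] -/
theorem fluctCoeff_njl (N k : ℕ) : fluctCoeff N (njlBondCoeff N) k = if k = 0 then 1 else 0 := by
  classical
  unfold fluctCoeff njlBondCoeff
  -- `∑_{j ≤ k} N^j/j! · (-N)^{k-j}/(k-j)! = (N + (-N))^k / k! = δ_{k0}` (binomial theorem)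
  have key : ∀ j ∈ range (k + 1),
      (N : ℝ) ^ j / (Nat.factorial j : ℝ) * (-(N : ℝ)) ^ (k - j) / (Nat.factorial (k - j) : ℝ) =
        ((N : ℝ) ^ j * (-(N : ℝ)) ^ (k - j) * (Nat.choose k j : ℝ)) / (Nat.factorial k : ℝ) := by
    intro j hj
    have hjk : j ≤ k := Nat.lt_succ_iff.mp (mem_range.mp hj)
    have hc : (Nat.choose k j : ℝ) * (Nat.factorial j : ℝ) * (Nat.factorial (k - j) : ℝ) =
        (Nat.factorial k : ℝ) := by
      exact_mod_cast Nat.choose_mul_factorial_mul_factorial hjk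
    have hj0 : (Nat.factorial j : ℝ) ≠ 0 := by positivity
    have hkj0 : (Nat.factorial (k - j) : ℝ) ≠ 0 := by positivity
    have hk0 : (Nat.factorial k : ℝ) ≠ 0 := by positivity
    field_simp
    rw [← hc]
    ring
  rw [sum_congr rfl key, ← sum_div, ← add_pow]
  simp only [add_neg_cancel]
  by_cases hk : k = 0
  · subst hk; simp
  · simp [zero_pow hk, hk]

end ComplexSpin

open ComplexSpin

/-- **Salmhofer–Seiler infrared bound** (CMP 139 (1991), Theorem 3.21), special case
`F_x(z) = e^{2Nmz}` (the case used in their Thm. 3.23, Remark 4.5 and Thm. 4.8), on the torus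
`Λ = (ℤ/Lℤ)^ν` with even side `L ≥ 4`.  As printed: "Let `Λ` be a torus,
`F_x(z) = F(z) = conj F(z̄)` for all `x ∈ Λ`, `B_xy(t) = exp N W(t)` for all `(x,y) ∈ Λ^{(1)}`, with
`W(t) = ∑_{k=1}^{N} w_k t^k`, `V(t) = W(t) - t`, and define `b_k` by `e^{NV(t)} = ∑_{k≥0} b_k t^k`.
If `b_k ≥ 0` for all `k ∈ {0,…,N}`, then for all `h : Λ → ℝ`,
`⟨σ(h) σ(-Δh)⟩_Λ ≤ (1/N) ‖h‖²` (3.74) and `⟨σ(h) σ(Δ̄h)⟩_Λ ≥ -(1/N) ‖h‖²` (3.75)", `Δ` the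
Laplacean, `Δ̄` its antiferromagnetic counterpart (3.76), `σ(h) = ∑_x σ_x h_x`, `‖h‖² = (h,h)`
(3.77).  Rendering: the bond weight is given by its Taylor data `a` with `a_0 = 1` (`B(0) = 1`)
and `a_1 = N` (the paper's standing normalisation `w₁ = 1`, Remark 3.4(4)), `b_k = fluctCoeff N a k`;
`N ≥ 1` is the number of colours, `m ∈ ℝ` the fermion mass; expectations `⟨·⟩_Λ` are `expect`
(coefficient extraction, Remark 3.2).  The `U(N)` lattice gauge theory at `β = 0` is
`a = uNBondCoeff N` (Remark 4.5: its `b_k ≥ 0`), strongly coupled QED / the NJL system is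
`a = njlBondCoeff N` (`b_k = δ_{k0}`, `fluctCoeff_njl`).  Proof in print: reflection positivity of
the background expectation (3.78), chessboard bounds, Gaussian domination (3.98)–(3.99), "similar
to [Fröhlich–Simon–Spencer]". [cite: SalmhoferSeiler1991, Thm. 3.21] -/
def SalmhoferSeiler1991_infraredBound : Prop :=
  ∀ (ν L N : ℕ) [NeZero L], Even L → 4 ≤ L → 1 ≤ N →
    ∀ (m : ℝ) (a : ℕ → ℝ), a 0 = 1 → a 1 = N → (∀ k ≤ N, 0 ≤ fluctCoeff N a k) →
      ∀ h : TorusSite ν L → ℝ,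
        expect N m a (field h * field fun x => -laplacian h x) ≤ (1 / N) * normSq h ∧
          -((1 / N) * normSq h) ≤ expect N m a (field h * field (afLaplacian h))

/-- The infrared bound for the `U(N)` lattice gauge theory at `β = 0`, every `N ≥ 1`, as a
consequence of the cited Thm. 3.21 and the proved Remark 4.5.
[cite: SalmhoferSeiler1991, Thm. 3.21 with Remark 4.5] -/
theorem SalmhoferSeiler1991_infraredBound.uN (h : SalmhoferSeiler1991_infraredBound)
    (ν L N : ℕ) [NeZero L] (hL : Even L) (hL4 : 4 ≤ L) (hN1 : 1 ≤ N) (m : ℝ)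
    (f : TorusSite ν L → ℝ) :
    expect N m (uNBondCoeff N) (field f * field fun x => -laplacian f x) ≤ (1 / N) * normSq f ∧
      -((1 / N) * normSq f) ≤ expect N m (uNBondCoeff N) (field f * field (afLaplacian f)) :=
  h ν L N hL hL4 hN1 m (uNBondCoeff N) (uNBondCoeff_zero N) (uNBondCoeff_one hN1)
    (fun k hk => uN_fluctCoeff_nonneg hN1 k hk) f

/-- The infrared bound for the NJL system / strongly coupled QED (`N = 1`), every `N ≥ 1`, as a
consequence of the cited Thm. 3.21 (Remark 3.22: `V = 0`). [cite: SalmhoferSeiler1991, Thm. 3.21 with Remark 3.22] -/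
theorem SalmhoferSeiler1991_infraredBound.njl (h : SalmhoferSeiler1991_infraredBound)
    (ν L N : ℕ) [NeZero L] (hL : Even L) (hL4 : 4 ≤ L) (hN1 : 1 ≤ N) (m : ℝ)
    (f : TorusSite ν L → ℝ) :
    expect N m (njlBondCoeff N) (field f * field fun x => -laplacian f x) ≤ (1 / N) * normSq f ∧
      -((1 / N) * normSq f) ≤ expect N m (njlBondCoeff N) (field f * field (afLaplacian f)) :=
  h ν L N hL hL4 hN1 m (njlBondCoeff N) (njlBondCoeff_zero N) (njlBondCoeff_one N)
    (fun k _ => by rw [fluctCoeff_njl]; split_ifs <;> norm_num) f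

end Literature.MathematicalPhysics.StatisticalMechanics
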